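import Summits.RiemannHypothesis.RiemannHypothesis.Theorems.TiltedLandingLaw421R3PurseHalf
import Summits.RiemannHypothesis.RiemannHypothesis.Theses.EarlyAppointments

/-! # trkD_v4q (half) — skeleton DRAFT for `TiltedLandingLaw421R` at `halfPurse` (C4 g29). -/

namespace Summit.RiemannHypothesis.RiemannHypothesis.Cruxes.TiltedLandingLaw421R.TrkDV4Q

set_option linter.dupNamespace false

theorem stub_restSuccBotQ : RhW08.SealSwapQ.RestSuccBotQ := by
  sorry

theorem stub_restRateBotQP : RhW08.PurseP.RestRateBotPQ RhW08.PurseP.halfPurse := by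
  sorry

theorem TiltedLandingLaw421R_of : Summit.RiemannHypothesis.RiemannHypothesis.Theses.EarlyAppointments.TiltedLandingLaw421R :=
  RhW08.PurseP.law421Half_of_succ_rate stub_restSuccBotQ stub_restRateBotQP

end Summit.RiemannHypothesis.RiemannHypothesis.Cruxes.TiltedLandingLaw421R.TrkDV4Q
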